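import Mathlib
import Summits.HubbardSuperconductivity.HubbardSuperconductivity.Theses.AposterioriCapRg

/-!
# Sketch — crux-ideate stmt-HubbardSuperconductivity-13884 (`AposterioriCapRg.AposterioriOrderCriterionR`), round 1, ideator 1

First lemmas of the idea card filed this round (they only need to ELABORATE; proofs are `sorry`):

* §A — card `log-concave-lift-brascamp-lieb` (the lever: lift the pair phase to `ℝ` on the small-gradient
  tube given the integer vorticity/winding form; the lifted sourced measure is LOG-CONCAVE, so Brascamp–Lieb /
  Bakry–Émery (A1) is the reflection-positivity-free infrared bound; A2 is its first model-level consequence: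
  the vortex-free ("tube") sector of ANY uniformly convex lifted rotor model on the `(2+1)`-torus `(ℤ/Lℤ)³` has
  phase coherence `E cos θ_x ≥ 1 - C/(2c)` uniformly in `L` — no Villain/Gaussian weights, no duality, no RP).
* §B — salvage from the dropped line "KLS with a spectral floor" (NOTES.md §Levers 2): the tilted single-mode
  variational bound turning two-point coherence of a SOURCED ground state into a one-point order-parameter gain
  at a larger source (Koma–Tasaki's double-commutator mechanism with a tilt `G = g(O)`); kept because the
  crux-plan of §A may prefer to assemble through it.
-/

noncomputable section

set_option linter.dupNamespace false
set_option linter.unusedVariables false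

namespace Summit.HubbardSuperconductivity.HubbardSuperconductivity.Cruxes.AposterioriOrderCriterionR.SketchIdeator1

open scoped BigOperators Matrix ComplexOrder ENNReal NNReal
open MeasureTheory ProbabilityTheory Real Finset Literature.Probability.LatticeModels

/-! ## §A  Card `log-concave-lift-brascamp-lieb` -/

/-- **A1 (Brascamp–Lieb / Bakry–Émery Poincaré inequality on a uniformly log-concave body).**
For a convex body `S ⊆ ℝ^ι`, a potential `V` that is `c`-strongly convex on `S`, and the probability measure
`μ ∝ 𝟙_S e^{-V} dx` (Mathlib: `(volume.restrict S).tilted (-V)`; the zero measure in the non-integrable junk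
case, for which the bound is trivial), every `K`-Lipschitz observable has `Var_μ f ≤ K²/c`.
(Brascamp–Lieb 1976, Thm 4.1 in the form `Var f ≤ ∫⟨∇f,(∇²V)⁻¹∇f⟩`; Bakry–Émery; the convex-constraint
case by approximation `V + n·dist(·,S)²`.)  This is the RP-free "Gaussian domination" the card runs on. -/
theorem variance_le_of_strongConvexOn {ι : Type*} [Fintype ι] {c : ℝ} (hc : 0 < c)
    {S : Set (EuclideanSpace ℝ ι)} (hS : Convex ℝ S) (hSm : MeasurableSet S)
    (V : EuclideanSpace ℝ ι → ℝ) (hV : StrongConvexOn S c V) (hVc : ContinuousOn V S)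
    (f : EuclideanSpace ℝ ι → ℝ) {K : ℝ≥0} (hf : LipschitzWith K f) :
    variance f (((volume : Measure (EuclideanSpace ℝ ι)).restrict S).tilted (fun x => -V x)) ≤
      (K : ℝ) ^ 2 / c := by
  sorry

section LiftedRotor

variable (L : ℕ) [NeZero L]

/-- Sites of the `(2+1)`-dimensional block lattice: the discrete 3-torus `(ℤ/Lℤ)³` (two block-space directions,
one imaginary-time direction; anisotropy is carried by direction-dependent link potentials `W i`). -/
abbrev Site3 : Type := TorusSite 3 L

/-- Lifted phase configurations, PINNED at the origin (`θ 0 = 0` kills the global `2πℤ`/zero mode): a real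
number per non-zero site. -/
abbrev LiftedCfg : Type := {x : Site3 L // x ≠ 0} → ℝ

variable {L}

/-- The lifted phase field extended by `θ 0 = 0`. -/
def ext (θ : LiftedCfg L) (x : Site3 L) : ℝ :=
  if h : x = 0 then 0 else θ ⟨x, h⟩

/-- The lifted link gradient `η_{x,i} = θ(x + eᵢ) - θ(x)` (a REAL number — the whole point of the lift). -/
def grad (θ : LiftedCfg L) (x : Site3 L) (i : Fin 3) : ℝ :=
  ext θ (x + Pi.single i 1) - ext θ x

variable (L)

/-- The small-gradient TUBE `{θ : |η_{x,i}| ≤ a ∀ x i}` — a CONVEX subset of configuration space (intersection of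
slabs); on it a potential convex on `[-a,a]` is convex in `θ`. In the card this is the vortex-free, small-field
sector given the integer form `n = 0`; general `n` shifts each slab by `2πn_{x,i}`, still convex. -/
def tube (a : ℝ) : Set (LiftedCfg L) :=
  {θ | ∀ (x : Site3 L) (i : Fin 3), |grad θ x i| ≤ a}

/-- The lifted energy `Σ_{x,i} W_i(η_{x,i})` for direction-dependent link potentials `W : Fin 3 → ℝ → ℝ`
(space links `i = 0,1`: block Josephson coupling; time links `i = 2`: block charging in Villain form; NOT
required to be cosines or Gaussians — only convex on `[-a,a]`). -/
def liftedEnergy (W : Fin 3 → ℝ → ℝ) (θ : LiftedCfg L) : ℝ :=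
  ∑ x : Site3 L, ∑ i : Fin 3, W i (grad θ x i)

/-- The tube-constrained lifted Gibbs measure `μ ∝ 𝟙_{tube a} e^{-Σ W_i(η)} dθ` (a probability measure: the
tube is bounded because `θ` is pinned, and has positive volume). -/
def liftedMeasure (W : Fin 3 → ℝ → ℝ) (a : ℝ) : Measure (LiftedCfg L) :=
  ((volume : Measure (LiftedCfg L)).restrict (tube L a)).tilted (fun θ => -liftedEnergy L W θ)

/-- **A2 (the vortex-free sector is ordered by convexity alone).** There is a universal `C` (any
`C > sup_L sup_x R^{(ℤ/L)³}_{eff}(0,x)`, the effective resistance of the unit 3-torus network, e.g. `C = 2`)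
such that for EVERY side `L`, tube width `a > 0`, convexity constant `c > 0` and every family of even link
potentials `W_i` that are `c`-strongly convex on `[-a,a]`, the pinned lifted field has
`Var(θ_x) ≤ C/c` and hence `E cos θ_x ≥ 1 - C/(2c)` for every site `x`, uniformly in `L`.
Proof sketch: the Hessian of `liftedEnergy` on the tube dominates `c · (grounded graph Laplacian)`, so
Brascamp–Lieb (A1 in matrix form) gives `Var θ_x ≤ c⁻¹ (Δ_grounded⁻¹)_{xx} = c⁻¹ R_eff(0,x) ≤ C/c`
(`d = 3`: bounded resistance); evenness of `W` makes the measure `θ ↦ -θ` symmetric, so `E θ_x = 0` and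
`cos u ≥ 1 - u²/2` finishes. With `c ≍ kStar` (block stiffness in units of the block lattice) this is the
`1 - O(1/kStar)` phase coherence of the card, for ARBITRARY convex (non-Villain) weights. -/
theorem tube_sector_phase_coherence :
    ∃ C : ℝ, 0 < C ∧ ∀ (L : ℕ) [NeZero L] (a c : ℝ), 0 < a → 0 < c →
      ∀ W : Fin 3 → ℝ → ℝ,
        (∀ i, StrongConvexOn (Set.Icc (-a) a) c (W i)) → (∀ i, ContinuousOn (W i) (Set.Icc (-a) a)) →
        (∀ i t, W i (-t) = W i t) →
        ∀ x : Site3 L,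
          variance (fun θ => ext θ x) (liftedMeasure L W a) ≤ C / c ∧
          1 - C / (2 * c) ≤ ∫ θ, Real.cos (ext θ x) ∂(liftedMeasure L W a) := by
  sorry

end LiftedRotor

/-! ## §B  Salvage: the tilted single-mode bound (two-point coherence at source `h` ⇒ one-point gain at source `h + h'`) -/

/-- **B1 (tilted single-mode variational bound).** `A` Hermitian (think `A = K - hO`, the sourced Hamiltonian),
`ψ` a ground vector of `A`, `O` the Hermitian order operator, `G` a Hermitian TILT (think `G = g(O)`, e.g.
`exp(εO/L²)`), `Gψ ≠ 0`. Then for every `h'`,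
`E₀(A - h'O) ≤ E₀(A) - h' · ⟨O⟩_{Gψ} + ⟨ψ, (GAG - ½(G²A + AG²)) ψ⟩ / ‖Gψ‖²`,
and the last numerator is the double commutator `½⟨ψ,[G,[A,G]]ψ⟩` (because `Aψ = E₀ψ`), of size `O(L^{d-2})`
for local `A` and `G = g(O/L^d)` — Koma–Tasaki's mechanism (tree: `KomaTasaki.horschVonDerLinden_holds`) with a
tilt instead of `G = O`. Use: if the sourced ground state has pair LRO (variance of `O/L²` bounded below), an
exponential tilt raises `⟨O⟩` by `c·L²`, so the order parameter at source `h + h'` gains `c/2` — the step that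
converts two-point phase coherence (what §A delivers most easily) into the one-point conclusion of R via the
in-tree energy-gain API `le_dWaveOrderParameter_of_le_liminf_energyGain`. Proof: Rayleigh quotient of the
trial vector `Gψ/‖Gψ‖` (tree: `groundEnergy_le_rayleigh_holds`) and `⟨ψ,G²Aψ⟩ = ⟨ψ,AG²ψ⟩ = E₀‖Gψ‖²`. -/
theorem groundEnergy_source_le_tilted {n : Type*} [Fintype n] [DecidableEq n]
    {A O G : Matrix n n ℂ} (hA : A.IsHermitian) (hO : O.IsHermitian) (hG : G.IsHermitian)
    (ψ : n → ℂ) (hψ : A *ᵥ ψ = (A.groundEnergy : ℂ) • ψ) (hGψ : G *ᵥ ψ ≠ 0) (h' : ℝ) :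
    (A - (h' : ℂ) • O).groundEnergy ≤
      A.groundEnergy
        - h' * ((star (G *ᵥ ψ) ⬝ᵥ (O *ᵥ (G *ᵥ ψ))).re / (star (G *ᵥ ψ) ⬝ᵥ (G *ᵥ ψ)).re)
        + (star ψ ⬝ᵥ ((G * A * G - (2⁻¹ : ℂ) • (G * G * A + A * G * G)) *ᵥ ψ)).re
            / (star (G *ᵥ ψ) ⬝ᵥ (G *ᵥ ψ)).re := by
  sorry

/-- The target this sketch serves (by name, so the audit block records it): the crux decl itself. Nothing is
claimed about it here. -/
example : Prop := Summit.HubbardSuperconductivity.HubbardSuperconductivity.Theses.AposterioriCapRg.AposterioriOrderCriterionR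

end Summit.HubbardSuperconductivity.HubbardSuperconductivity.Cruxes.AposterioriOrderCriterionR.SketchIdeator1
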